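import Summits.QuantumFields.YangMills.Theorems.BalabanUVNodesN15AnyPropagatorSandwichObjects
import Summits.QuantumFields.YangMills.Theorems.BalabanUVNodesN15GenericSandwichLetters
import HarnessLib

/-!
# N15 = NE2 — PROGRAMME 𝟙P «ONE PROPAGATOR», part (𝟙P-b): ★★★ THE THREE LETTERS OF THE SITE∕UNIT MIDDLE FACTOR FOR ANY LIVE PROPAGATOR WITH THREE DISPLAYED ROWS ON ITS INCREMENT
# (dag-n15-a g32, FILE (𝟙P-b); node N15 = NE2; `--kind proof --supports stmt-QuantumFields-27366 --as helper`, count-neutral; theorems only, 0 def; imports (𝟙P-a), (Q-1))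

WHY ∕ HOW.  (Q-2b) `exists_zCov_letters` proved Σ-col (H)'s three hypotheses for the middle factor with the covariant averaging `Q⊗1 + D` on dag-n15-c's FILE 133 propagator (covariant
averaging summand FLAT inside), its three inputs hard-wired: (J-b′) `exists_zLive_letters`, FILE 133 `sf_cvGlued_pair_spec`, FILE 130 `sf_idef_cvGlued`.  Here the inner propagator is an
ARBITRARY pair of linear maps `(X, X′)` on the cover's coloured 1-forms at the two spacings, and ALL that is asked of it is DISPLAYED as three block-majorant rows on the INCREMENT over the flat
zero-field propagator: `|X − G⊗1| ≤ ζ·e^{−ρ_X d}`, `|X′ − G′⊗1| ≤ ζ·e^{−ρ_X d}` (`0 ≤ ζ ≤ 1`), and the two-grid η-defect along King's pairing `|𝔇(X′ − G′⊗1, X − G⊗1)| ≤ θ·e^{−ρ_X d}` —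
(I-b)∕(I-c)'s CONCLUSIONS as hypotheses.  The flat pair's own letters (FILE 21 `uniform_layer_fullGM₂`: decay of `G⊗1`, `G′⊗1`, their two-grid defect `m₀(L^k)^{−1∕16}`) are the lane's and
enter by name, so `X = (X − G⊗1) + G⊗1` has the row `(ζ + β_G)e^{−ρd}` and `𝔇(X′, X) = 𝔇(increments) + 𝔇(G′⊗1, G⊗1)` (`idef_add`).  The three summands of (𝟙P-a) `zAnyC_split` and their
two-grid differences are then six applications of (Q-1) `hasMaj_sandwich_exp_ofBlocks` ∕ `hasMaj_sandwich_sub_exp_ofBlocks` with the stencil letters (J-a) `hasMaj_tensorId_qvRe∕AdjRe`,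
part 45 `hasMaj_qvAdjRe_sub_pull_comp`, FILE 99 `hasMaj_qvRe_pull_sub_comp_of_line` (`⊗ 1_ι`), read as coloured entry letters by (J-a) §2 `abs_unitBondMatC_le_of_hasMaj`; scalar budgets
(𝟙P-a) §3.  NO regime, NO potential, NO trace form: pure block-majorant bookkeeping — the regime enters only through the rows of an instance ((𝟙P-e) for dag-n15-c's `X_q`).

WHAT.  ★★★ `exists_zAny_letters`: for every rate `ρ_X > 0` there are `ρ ≤ ρ_X`, `δ, K > 0` (from `d, L, a, ι, ρ_X`) such that for all `k ≥ 1`, all `(X, X′)` with the three increment rows at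
rate `ρ_X` (amplitudes `0 ≤ ζ ≤ 1`, `0 ≤ θ`) and all averaging perturbations `D, E, D′, E′` with (Q-2b)'s six rows at rate `ρ` (sizes `0 ≤ ρ_D, ρ_E ≤ 1`, comparisons `τ_D, τ_E ≥ 0`):
(i) `|zAnyC X D E (p,q)| ≤ K·(ζ + ρ_D + ρ_E)·e^{−δ·cdist}`, (ii) the same for `zAnyF X′ D′ E′`, (iii) `|zAnyF − zAnyC| ≤ K·(θ + (ζ + ρ_D + ρ_E)·(L^k)^{−1∕16} + τ_D + τ_E)·e^{−δ·cdist}`.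
At `X = G⊗1` (`ζ = θ = 0`) with the flat averaging every amplitude vanishes.

HONEST FRAMING ∕ LIMITS.  Block-majorant bookkeeping over landed rows and the lane's flat-pair letters; NO propagator constructed, no row of any instance proved here; the covariant averaging
MODELLED as `Q⊗1 + D` with displayed rows ([B9] (3.81)'s shape; [5] (124) not typed); no layer of NE2 proved; NOT [B9] Thms 3.1∕3.2∕3.15 AS PRINTED; N15 stays DISCHARGED OF RECORD 8∕28 AS
CONSUMED (U-blind v7 pin, p687738) — nothing re-claimed, no count moved; K3⁸ OPEN; finite 𝕋⁴ per index — NOT ℝ⁴ ∕ OS ∕ mass gap ∕ Clay.  `set_option maxHeartbeats 800000 in` ×1 ((Q-2b)'s budget).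
No `sorry`, `def`, `instance`, `notation`; standard axioms.
[cite: Balaban1985BackgroundPropagators, Thm 3.1 (3.42) p.397, Thm 3.2 (3.48) p.398 («with the same constants»), (3.78)–(3.81) p.406, (3.62)–(3.65) pp.402–403 (η-rate: shape); Balaban1984PropagatorsI, (1.18) p.20,
(1.102)–(1.103) p.34, Prop. 1.2 (1.110)–(1.111) p.35; Balaban1984PropagatorsII, (2.52)–(2.56) pp.232–233, Lemma 2.1 (2.61) p.234, (2.156) p.250; King1986, p.664 (the pairing), Prop. 3.9 (3.73) p.665 (η-rate shape)]
-/

open scoped BigOperators Matrix Matrix.Norms.Frobenius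

namespace Summit.QuantumFields.YangMills.BalabanUVNodes.N15.GluedZeroField

open Literature.MathematicalPhysics.QuantumFieldTheory.Balaban1983to89
open Literature.MathematicalPhysics.QuantumFieldTheory.King1986 (exp_decay_mono)
open Literature.MathematicalPhysics.QuantumFieldTheory.Balaban1983to89.B5Prop11Plancherel (Tor fine)
open Literature.MathematicalPhysics.QuantumFieldTheory.Balaban1983to89.B6Lemma24Torus (pbox)
open Literature.MathematicalPhysics.QuantumFieldTheory.Balaban1983to89.B6RandomWalk (Triangle254)
open Literature.MathematicalPhysics.QuantumFieldTheory.Balaban1983to89.B11SectG (BlockNorm HasMaj RowSum hasMaj_comp_exp)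
open Literature.MathematicalPhysics.QuantumFieldTheory.Balaban1983to89.B9Eq3130MatrixLetters (hasMaj_id_ofBlocks)
open Literature.MathematicalPhysics.QuantumFieldTheory.Balaban1983to89.B6UnitTorusCarrier (unitTorusGeo unitTorusGeo_dist unitTorusGeo_dist_nonneg unitTorusGeo_dist_self triangle254_unitTorusGeo rowSum_unitTorusGeo)
open Literature.MathematicalPhysics.QuantumFieldTheory.Balaban1983to89.T4EtaRateDefect (idef idef_add)
open Literature.MathematicalPhysics.QuantumFieldTheory.Balaban1983to89.T4EtaRateCoeffDefect (pull)
open Literature.MathematicalPhysics.QuantumFieldTheory.King1986.Torus (blockOf tdistT)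
open Summit.QuantumFields.YangMills.BalabanUVNodes.N15.BackgroundLayer (tensorId_sub tensorId_comp_tensorId uniform_layer_fullGM₂)
open Summit.QuantumFields.YangMills.BalabanUVNodes.N15.BackgroundModel (kappa_ofBlocks)
open Summit.QuantumFields.YangMills.BalabanUVNodes.N15.SiteLayer (hasMaj_exp_mono hasMaj_add_exp)
open Summit.QuantumFields.YangMills.BalabanUVNodes.N15.VectorPiece (bshiftEquiv kingPrV blkFine tensorId tensorId_apply hasMaj_tensorId blkFine_comp_kingPrV)
open Summit.QuantumFields.YangMills.BalabanUVNodes.N15.MatrixSpecies (liftBlk liftMap)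
open Summit.QuantumFields.YangMills.BalabanUVNodes.N15.TwoGrid (gOp qvRe qvAdjRe symbOp sD sA hasMaj_qvAdjRe_sub_pull_comp)
open Summit.QuantumFields.YangMills.BalabanUVNodes.N15.UnitLayerBgCol (unitBondMatC unitBondMatC_add unitBondMatC_sub unitBondMatC_zero cdist cdist_nonneg)
open Summit.QuantumFields.YangMills.BalabanUVNodes.N15.Gluing (cvM CvX CvX' cvBlk CvNorm hasMaj_lineDiff_comp hasMaj_qvRe_pull_sub_comp_of_line)

variable (d : ℕ) {L : ℕ} [NeZero L] (ι : Type) [Fintype ι] [DecidableEq ι] (a : ℝ)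

/-! ## ★★★ The three letters of the middle factor for any propagator, from three displayed rows on its increment -/

set_option maxHeartbeats 800000 in
/-- ★★★ **THE THREE LETTERS OF THE SITE∕UNIT MIDDLE FACTOR FOR ANY LIVE PROPAGATOR.**  `L > 1` odd, `a > 0`, a rate `ρ_X > 0`.  There are `ρ ∈ (0, ρ_X]`, `δ > 0`, `K > 0` (from `d, L, a, ι, ρ_X`
only; `ρ` = the rate at which the averaging-perturbation rows are read) such that for every `k ≥ 1`, every pair of inner propagators `(X, X′)` (coarse spacing `L^{−k}`, fine `L^{−(r+k)}`) whose
INCREMENTS over the flat zero-field pair carry the three DISPLAYED rows at rate `ρ_X` — `|X − G⊗1|, |X′ − G′⊗1| ≤ ζ·e^{−ρ_X d}` (`0 ≤ ζ ≤ 1`), `|𝔇_P(X′ − G′⊗1, X − G⊗1)| ≤ θ·e^{−ρ_X d}` along King's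
pairing `P` (`θ ≥ 0`) — and for ALL averaging perturbations `D, E` (coarse), `D′, E′` (fine) with the six displayed rows of (Q-2b) at rate `ρ` (sizes `0 ≤ ρ_D, ρ_E ≤ 1`; comparison rows
`D′∘P − D ≤ τ_D·e^{−ρd}`, `E′ − P∘E ≤ τ_E·e^{−ρd}`), the middle factors `Z = zAnyC X D E`, `Z′ = zAnyF X′ D′ E′` satisfy (i) `|Z(p,q)| ≤ K·(ζ + ρ_D + ρ_E)·e^{−δ·cdist(p,q)}`, (ii) the same for
`Z′`, (iii) `|Z′(p,q) − Z(p,q)| ≤ K·(θ + (ζ + ρ_D + ρ_E)·(L^k)^{−1∕16} + τ_D + τ_E)·e^{−δ·cdist(p,q)}` — Σ-col (H) `exDress_deltaCol_letters`' three hypotheses with `ζ_H = K(ζ + ρ_D + ρ_E)`,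
`τ_H = K(θ + (ζ + ρ_D + ρ_E)(L^k)^{−1∕16} + τ_D + τ_E)`.  Rows of an instance: (I-b)∕(I-c) for dag-n15-c's FILE 133 propagator; (𝟙P-e) for their `X_q` with the covariant averaging summand live.
[cite: Balaban1985BackgroundPropagators, Thm 3.2 (3.48) p.398, (3.78)–(3.81) p.406, Thm 3.1 (3.42) p.397 (η-rate shape), (3.62)–(3.65) pp.402–403; Balaban1984PropagatorsI, (1.18) p.20, (1.102)–(1.103) p.34, Prop. 1.2 (1.110)–(1.111) p.35;
Balaban1984PropagatorsII, (2.52)–(2.56) pp.232–233, Lemma 2.1 (2.61) p.234, (2.156) p.250; King1986, p.664, Prop. 3.9 (3.73) p.665] -/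
theorem exists_zAny_letters [Nonempty ι] (hL : Odd L ∧ 1 < L) (ha : 0 < a) {ρX : ℝ} (hρX : 0 < ρX) :
    ∃ ρ δ K : ℝ, 0 < ρ ∧ ρ ≤ ρX ∧ 0 < δ ∧ 0 < K ∧
      ∀ (mv kk r : ℕ), 1 ≤ kk →
      ∀ (Xc : (CvX d L mv kk hL × ι → ℝ) →ₗ[ℝ] (CvX d L mv kk hL × ι → ℝ)) (Xf : (CvX' d L mv kk r hL × ι → ℝ) →ₗ[ℝ] (CvX' d L mv kk r hL × ι → ℝ)) (ζ θ : ℝ),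
        0 ≤ ζ → ζ ≤ 1 → 0 ≤ θ →
        HasMaj (CvNorm d L mv kk hL ι) (CvNorm d L mv kk hL ι) (Xc - tensorId ι (gOp (cvM d L mv kk hL) (L ^ kk) a))
          (fun y y' => ζ * Real.exp (-(ρX * (unitTorusGeo L kk (cvM d L mv kk hL)).dist y y'))) →
        HasMaj (BlockNorm.ofBlocks (unitTorusGeo L kk (cvM d L mv kk hL)) (liftBlk (fun b : CvX' d L mv kk r hL => blockOf (L ^ r * L ^ kk) (cvM d L mv kk hL) b.1) ι))
          (BlockNorm.ofBlocks (unitTorusGeo L kk (cvM d L mv kk hL)) (liftBlk (fun b : CvX' d L mv kk r hL => blockOf (L ^ r * L ^ kk) (cvM d L mv kk hL) b.1) ι))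
          (Xf - tensorId ι (gOp (cvM d L mv kk hL) (L ^ r * L ^ kk) a))
          (fun y y' => ζ * Real.exp (-(ρX * (unitTorusGeo L kk (cvM d L mv kk hL)).dist y y'))) →
        HasMaj (CvNorm d L mv kk hL ι) (BlockNorm.ofBlocks (unitTorusGeo L kk (cvM d L mv kk hL)) (liftBlk (fun b : CvX' d L mv kk r hL => blockOf (L ^ r * L ^ kk) (cvM d L mv kk hL) b.1) ι))
          (idef (pull (liftMap (kingPrV L kk r (cvM d L mv kk hL)) ι)) (pull (liftMap (kingPrV L kk r (cvM d L mv kk hL)) ι))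
            (Xf - tensorId ι (gOp (cvM d L mv kk hL) (L ^ r * L ^ kk) a)) (Xc - tensorId ι (gOp (cvM d L mv kk hL) (L ^ kk) a)))
          (fun y y' => θ * Real.exp (-(ρX * (unitTorusGeo L kk (cvM d L mv kk hL)).dist y y'))) →
      ∀ (D : (CvX d L mv kk hL × ι → ℝ) →ₗ[ℝ] ((Tor (cvM d L mv kk hL) × Fin (d + 1)) × ι → ℝ))
        (E : ((Tor (cvM d L mv kk hL) × Fin (d + 1)) × ι → ℝ) →ₗ[ℝ] (CvX d L mv kk hL × ι → ℝ))
        (D' : (CvX' d L mv kk r hL × ι → ℝ) →ₗ[ℝ] ((Tor (cvM d L mv kk hL) × Fin (d + 1)) × ι → ℝ))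
        (E' : ((Tor (cvM d L mv kk hL) × Fin (d + 1)) × ι → ℝ) →ₗ[ℝ] (CvX' d L mv kk r hL × ι → ℝ))
        (ρD ρE τD τE : ℝ), 0 ≤ ρD → ρD ≤ 1 → 0 ≤ ρE → ρE ≤ 1 → 0 ≤ τD → 0 ≤ τE →
        HasMaj (CvNorm d L mv kk hL ι) (BlockNorm.ofBlocks (unitTorusGeo L kk (cvM d L mv kk hL)) (liftBlk (fun b : Tor (cvM d L mv kk hL) × Fin (d + 1) => b.1) ι)) D
          (fun y y' => ρD * Real.exp (-(ρ * (unitTorusGeo L kk (cvM d L mv kk hL)).dist y y'))) →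
        HasMaj (BlockNorm.ofBlocks (unitTorusGeo L kk (cvM d L mv kk hL)) (liftBlk (fun b : CvX' d L mv kk r hL => blockOf (L ^ r * L ^ kk) (cvM d L mv kk hL) b.1) ι))
          (BlockNorm.ofBlocks (unitTorusGeo L kk (cvM d L mv kk hL)) (liftBlk (fun b : Tor (cvM d L mv kk hL) × Fin (d + 1) => b.1) ι)) D'
          (fun y y' => ρD * Real.exp (-(ρ * (unitTorusGeo L kk (cvM d L mv kk hL)).dist y y'))) →
        HasMaj (BlockNorm.ofBlocks (unitTorusGeo L kk (cvM d L mv kk hL)) (liftBlk (fun b : Tor (cvM d L mv kk hL) × Fin (d + 1) => b.1) ι)) (CvNorm d L mv kk hL ι) E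
          (fun y y' => ρE * Real.exp (-(ρ * (unitTorusGeo L kk (cvM d L mv kk hL)).dist y y'))) →
        HasMaj (BlockNorm.ofBlocks (unitTorusGeo L kk (cvM d L mv kk hL)) (liftBlk (fun b : Tor (cvM d L mv kk hL) × Fin (d + 1) => b.1) ι))
          (BlockNorm.ofBlocks (unitTorusGeo L kk (cvM d L mv kk hL)) (liftBlk (fun b : CvX' d L mv kk r hL => blockOf (L ^ r * L ^ kk) (cvM d L mv kk hL) b.1) ι)) E'
          (fun y y' => ρE * Real.exp (-(ρ * (unitTorusGeo L kk (cvM d L mv kk hL)).dist y y'))) →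
        HasMaj (CvNorm d L mv kk hL ι) (BlockNorm.ofBlocks (unitTorusGeo L kk (cvM d L mv kk hL)) (liftBlk (fun b : Tor (cvM d L mv kk hL) × Fin (d + 1) => b.1) ι))
          (D' ∘ₗ pull (liftMap (kingPrV L kk r (cvM d L mv kk hL)) ι) - D)
          (fun y y' => τD * Real.exp (-(ρ * (unitTorusGeo L kk (cvM d L mv kk hL)).dist y y'))) →
        HasMaj (BlockNorm.ofBlocks (unitTorusGeo L kk (cvM d L mv kk hL)) (liftBlk (fun b : Tor (cvM d L mv kk hL) × Fin (d + 1) => b.1) ι))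
          (BlockNorm.ofBlocks (unitTorusGeo L kk (cvM d L mv kk hL)) (liftBlk (fun b : CvX' d L mv kk r hL => blockOf (L ^ r * L ^ kk) (cvM d L mv kk hL) b.1) ι))
          (E' - pull (liftMap (kingPrV L kk r (cvM d L mv kk hL)) ι) ∘ₗ E)
          (fun y y' => τE * Real.exp (-(ρ * (unitTorusGeo L kk (cvM d L mv kk hL)).dist y y'))) →
        (∀ p q, |zAnyC d ι a hL mv kk Xc D E p q| ≤ K * (ζ + ρD + ρE) * Real.exp (-(δ * cdist (cvM d L mv kk hL) ι p q))) ∧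
        (∀ p q, |zAnyF d ι a hL mv kk r Xf D' E' p q| ≤ K * (ζ + ρD + ρE) * Real.exp (-(δ * cdist (cvM d L mv kk hL) ι p q))) ∧
        (∀ p q, |zAnyF d ι a hL mv kk r Xf D' E' p q - zAnyC d ι a hL mv kk Xc D E p q|
          ≤ K * (θ + (ζ + ρD + ρE) * ((((L ^ kk : ℕ) : ℝ)) ^ (-(1 / 16 : ℝ))) + τD + τE) * Real.exp (-(δ * cdist (cvM d L mv kk hL) ι p q))) := by
  have hLpos : 0 < L := Nat.pos_of_ne_zero (NeZero.ne L)
  have hL2 : 2 ≤ L := hL.2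
  -- FILE 21: the flat pair `(G′, G) ⊗ 1_ι` — decay at both spacings and its two-grid defect (exponent `1∕16`), rate `δ_G ≤ ρ_X`
  obtain ⟨δG, βG, m₀, cT, mT, hδG, hδGX, hβG, hm₀, -, -, -, HG⟩ :=
    uniform_layer_fullGM₂ d ι hL.1 hL2 hL ha (γ := 1 / 16) (by norm_num) le_rfl 0 hρX le_rfl
  -- the base rate `ρ₀ := δ_G`; row sums at `ρ₀∕2`, `ρ₀∕4`
  have hσ₂ : 0 < δG / 2 := by positivity
  have hσ₄ : 0 < δG / 4 := by positivity
  set c₂ : ℝ := B4Sect5Proof.latticeConst (d + 1) (δG / 2) + 1 with hc₂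
  set c₄ : ℝ := B4Sect5Proof.latticeConst (d + 1) (δG / 4) + 1 with hc₄
  have hc₂0 : 0 < c₂ := by have := B4Sect5Proof.latticeConst_nonneg (d + 1) hσ₂.le; rw [hc₂]; linarith
  have hc₄0 : 0 < c₄ := by have := B4Sect5Proof.latticeConst_nonneg (d + 1) hσ₄.le; rw [hc₄]; linarith
  have he₀0 : 0 < Real.exp δG := Real.exp_pos _
  -- the size of the full propagator `X = (X − G⊗1) + G⊗1` (`ζ ≤ 1`)
  set BX : ℝ := 1 + βG with hBX
  have hBX0 : 0 < BX := by positivity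
  set K : ℝ := c₂ * c₄ * (Real.exp δG * Real.exp δG + BX * (Real.exp δG + 1) + Real.exp δG * BX) + 4 * (c₂ * c₄) * ampUnit (Real.exp δG) BX m₀ + 1 with hK
  have hcc0 : 0 ≤ c₂ * c₄ := by positivity
  have hKpos : 0 < K := by
    have h1 : 0 ≤ c₂ * c₄ * (Real.exp δG * Real.exp δG + BX * (Real.exp δG + 1) + Real.exp δG * BX) := by positivity
    have h2 : 0 ≤ 4 * (c₂ * c₄) * ampUnit (Real.exp δG) BX m₀ := mul_nonneg (by positivity) (ampUnit_nonneg he₀0.le hBX0.le hm₀.le)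
    rw [hK]; linarith
  refine ⟨δG, δG / 4, K, hδG, hδGX, hσ₄, hKpos, fun mv kk r hk => ?_⟩
  intro Xc Xf ζ θ hζ hζ1 hθ hYc hYf hYd
  set M := cvM d L mv kk hL with hM
  intro D E D' E' ρD ρE τD τE hρD hρD1 hρE hρE1 hτD hτE hDc hDf hEc hEf hDd hEd
  have hkpos : (0 : ℝ) < ((L ^ kk : ℕ) : ℝ) := Nat.cast_pos.mpr (pow_pos hLpos kk)
  have hx1 : (1 : ℝ) ≤ ((L ^ kk : ℕ) : ℝ) := by exact_mod_cast Nat.one_le_pow kk L hLpos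
  have hθ0 : 0 ≤ (((L ^ kk : ℕ) : ℝ)) ^ (-(1 / 16 : ℝ)) := Real.rpow_nonneg hkpos.le _
  have hη0 : 0 ≤ ((((L ^ kk : ℕ) : ℝ))⁻¹) := inv_nonneg.mpr hkpos.le
  have hηθ : ((((L ^ kk : ℕ) : ℝ))⁻¹) ≤ (((L ^ kk : ℕ) : ℝ)) ^ (-(1 / 16 : ℝ)) := inv_le_rpow_neg_sixteenth hx1
  have hcast : ((L : ℝ) ^ kk) = (((L ^ kk : ℕ) : ℝ)) := by push_cast; rfl
  have htri := triangle254_unitTorusGeo L kk M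
  have hd := fun y y' => unitTorusGeo_dist_nonneg L kk M y y'
  have hrow₂ : RowSum (unitTorusGeo L kk M) (δG / 2) c₂ := fun y => (rowSum_unitTorusGeo L kk M hσ₂ y).trans (by rw [hc₂]; linarith)
  have hrow₄ : RowSum (unitTorusGeo L kk M) (δG / 4) c₄ := fun y => (rowSum_unitTorusGeo L kk M hσ₄ y).trans (by rw [hc₄]; linarith)
  -- FILE 21 at this index: `G ⊗ 1` coarse, `G′ ⊗ 1` fine (blocks `blkFine ∘ kingPrV` = the cover's fine blocks), `𝔇(G′⊗1, G⊗1)`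
  obtain ⟨hG0, -, hG0', -, -, hDG0, -⟩ := HG (⟨mv + 1, kk, hk, r⟩, (0 : Fin (d + 1)))
  have hG : HasMaj (CvNorm d L mv kk hL ι) (CvNorm d L mv kk hL ι) (tensorId ι (gOp M (L ^ kk) a))
      (fun y y' => βG * Real.exp (-(δG * (unitTorusGeo L kk M).dist y y'))) := hG0
  rw [blkFine_comp_kingPrV] at hG0' hDG0
  have hG' : HasMaj (BlockNorm.ofBlocks (unitTorusGeo L kk M) (liftBlk (fun b : CvX' d L mv kk r hL => blockOf (L ^ r * L ^ kk) M b.1) ι))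
      (BlockNorm.ofBlocks (unitTorusGeo L kk M) (liftBlk (fun b : CvX' d L mv kk r hL => blockOf (L ^ r * L ^ kk) M b.1) ι)) (tensorId ι (gOp M (L ^ r * L ^ kk) a))
      (fun y y' => βG * Real.exp (-(δG * (unitTorusGeo L kk M).dist y y'))) := hG0'
  have hDG : HasMaj (CvNorm d L mv kk hL ι) (BlockNorm.ofBlocks (unitTorusGeo L kk M) (liftBlk (fun b : CvX' d L mv kk r hL => blockOf (L ^ r * L ^ kk) M b.1) ι))
      (idef (pull (liftMap (kingPrV L kk r M) ι)) (pull (liftMap (kingPrV L kk r M) ι)) (tensorId ι (gOp M (L ^ r * L ^ kk) a)) (tensorId ι (gOp M (L ^ kk) a)))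
      (fun y y' => m₀ * ((L : ℝ) ^ kk) ^ (-(1 / 16 : ℝ)) * Real.exp (-(δG * (unitTorusGeo L kk M).dist y y'))) := hDG0
  rw [hcast] at hDG
  -- the increment rows at the base rate
  have hYc₀ := hasMaj_exp_mono hd hζ hδGX hYc
  have hYf₀ := hasMaj_exp_mono hd hζ hδGX hYf
  have hYd₀ := hasMaj_exp_mono hd hθ hδGX hYd
  -- the full propagator: `X = (X − G⊗1) + G⊗1`, size `ζ + β_G ≤ B_X`
  have hBXle : ζ + βG ≤ BX := by rw [hBX]; linarith
  have hXc₀ : HasMaj (CvNorm d L mv kk hL ι) (CvNorm d L mv kk hL ι) Xc (fun y y' => BX * Real.exp (-(δG * (unitTorusGeo L kk M).dist y y'))) := by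
    have h := hasMaj_add_exp hYc₀ hG
    rw [sub_add_cancel] at h
    exact h.mono fun y y' => mul_le_mul_of_nonneg_right hBXle (Real.exp_nonneg _)
  have hXf₀ : HasMaj (BlockNorm.ofBlocks (unitTorusGeo L kk M) (liftBlk (fun b : CvX' d L mv kk r hL => blockOf (L ^ r * L ^ kk) M b.1) ι))
      (BlockNorm.ofBlocks (unitTorusGeo L kk M) (liftBlk (fun b : CvX' d L mv kk r hL => blockOf (L ^ r * L ^ kk) M b.1) ι)) Xf
      (fun y y' => BX * Real.exp (-(δG * (unitTorusGeo L kk M).dist y y'))) := by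
    have h := hasMaj_add_exp hYf₀ hG'
    rw [sub_add_cancel] at h
    exact h.mono fun y y' => mul_le_mul_of_nonneg_right hBXle (Real.exp_nonneg _)
  -- the two-grid defect of the full pair: `𝔇(X′, X) = 𝔇(X′ − G′⊗1, X − G⊗1) + 𝔇(G′⊗1, G⊗1)`, amplitude `θ + m₀(L^k)^{−1∕16}`
  have hXI : HasMaj (CvNorm d L mv kk hL ι) (BlockNorm.ofBlocks (unitTorusGeo L kk M) (liftBlk (fun b : CvX' d L mv kk r hL => blockOf (L ^ r * L ^ kk) M b.1) ι))
      (idef (pull (liftMap (kingPrV L kk r M) ι)) (pull (liftMap (kingPrV L kk r M) ι)) Xf Xc)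
      (fun y y' => (θ + m₀ * ((((L ^ kk : ℕ) : ℝ)) ^ (-(1 / 16 : ℝ)))) * Real.exp (-(δG * (unitTorusGeo L kk M).dist y y'))) := by
    have h := hasMaj_add_exp hYd₀ hDG
    rw [← idef_add, sub_add_cancel, sub_add_cancel] at h
    exact h
  -- the flat averaging rows ⊗ 1_ι at the base rate, and the perturbed ones
  have hQc := hasMaj_tensorId_qvRe (L := L) M kk (L ^ kk) ι hδG.le
  have hQf := hasMaj_tensorId_qvRe (L := L) M kk (L ^ r * L ^ kk) ι hδG.le
  have hAc := hasMaj_tensorId_qvAdjRe (L := L) M kk (L ^ kk) ι hδG.le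
  have hAf := hasMaj_tensorId_qvAdjRe (L := L) M kk (L ^ r * L ^ kk) ι hδG.le
  have hAUc := hasMaj_add_exp hAc hEc
  have hAUf := hasMaj_add_exp hAf hEf
  -- the two-grid comparison rows: part 45 (`Q′* − PQ*`) ⊗ 1_ι (plus `E′ − PE`); FILE 99 (`Q′P − Q` on rough inputs) ⊗ 1_ι (plus `D′P − D`)
  have h45 := hasMaj_qvAdjRe_sub_pull_comp M kk r (B := 1) zero_le_one hδG.le
    (hasMaj_id_ofBlocks (g := unitTorusGeo L kk M) (fun b : Tor M × Fin (d + 1) => b.1) (unitTorusGeo_dist_self L kk M) δG)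
  rw [LinearMap.comp_id] at h45
  have hb := hasMaj_tensorId ι (fun y y' => by positivity) h45
  rw [tensorId_sub, ← tensorId_comp_tensorId, tensorId_pull] at hb
  have hAUd : HasMaj (BlockNorm.ofBlocks (unitTorusGeo L kk M) (liftBlk (fun b : Tor M × Fin (d + 1) => b.1) ι))
      (BlockNorm.ofBlocks (unitTorusGeo L kk M) (liftBlk (fun b : CvX' d L mv kk r hL => blockOf (L ^ r * L ^ kk) M b.1) ι))
      ((tensorId ι (qvAdjRe M (L ^ r * L ^ kk)) + E') - pull (liftMap (kingPrV L kk r M) ι) ∘ₗ (tensorId ι (qvAdjRe M (L ^ kk)) + E))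
      (fun y y' => (2 * Real.exp δG / (L : ℝ) ^ kk * 1 + τE) * Real.exp (-(δG * tdistT M y y'))) := by
    have hsplitA : (tensorId ι (qvAdjRe M (L ^ r * L ^ kk)) + E') - pull (liftMap (kingPrV L kk r M) ι) ∘ₗ (tensorId ι (qvAdjRe M (L ^ kk)) + E) =
        (tensorId ι (qvAdjRe M (L ^ r * L ^ kk)) - pull (liftMap (kingPrV L kk r M) ι) ∘ₗ tensorId ι (qvAdjRe M (L ^ kk))) + (E' - pull (liftMap (kingPrV L kk r M) ι) ∘ₗ E) := by
      rw [LinearMap.comp_add]; abel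
    rw [hsplitA]; exact hasMaj_add_exp hb hEd
  have h0 := hasMaj_id_ofBlocks (g := unitTorusGeo L kk M) (blkFine L kk M) (unitTorusGeo_dist_self (L := L) (k := kk) (M := M)) δG
  have hline : ∀ κ : Fin (d + 1), HasMaj (BlockNorm.ofBlocks (unitTorusGeo L kk M) (blkFine L kk M)) (BlockNorm.ofBlocks (unitTorusGeo L kk M) (blkFine L kk M))
      ((((L ^ kk : ℕ) : ℝ)⁻¹ • symbOp M (L ^ kk) (sD M (L ^ kk) κ ((L ^ kk : ℕ) : ℝ))) ∘ₗ (symbOp M (L ^ kk) (sA M (L ^ kk) κ (L ^ kk)) ∘ₗ LinearMap.id))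
      (fun y y' => 2 * Real.exp δG / ((L ^ kk : ℕ) : ℝ) * 1 * Real.exp (-(δG * tdistT M y y'))) := fun κ =>
    hasMaj_lineDiff_comp M kk (L ^ kk) zero_le_one hδG.le κ h0
  have h99 := hasMaj_qvRe_pull_sub_comp_of_line M kk r (B := 2 * Real.exp δG / ((L ^ kk : ℕ) : ℝ) * 1) (by positivity) hline
  rw [LinearMap.comp_id] at h99
  have hc := hasMaj_tensorId ι (fun y y' => by positivity) h99
  rw [tensorId_sub, ← tensorId_comp_tensorId, tensorId_pull] at hc
  have hQUd : HasMaj (CvNorm d L mv kk hL ι) (BlockNorm.ofBlocks (unitTorusGeo L kk M) (liftBlk (fun b : Tor M × Fin (d + 1) => b.1) ι))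
      ((tensorId ι (qvRe M (L ^ r * L ^ kk)) + D') ∘ₗ pull (liftMap (kingPrV L kk r M) ι) - (tensorId ι (qvRe M (L ^ kk)) + D))
      (fun y y' => (2 * Real.exp δG / ((L ^ kk : ℕ) : ℝ) * 1 + τD) * Real.exp (-(δG * tdistT M y y'))) := by
    have hsplitQ : (tensorId ι (qvRe M (L ^ r * L ^ kk)) + D') ∘ₗ pull (liftMap (kingPrV L kk r M) ι) - (tensorId ι (qvRe M (L ^ kk)) + D) =
        (tensorId ι (qvRe M (L ^ r * L ^ kk)) ∘ₗ pull (liftMap (kingPrV L kk r M) ι) - tensorId ι (qvRe M (L ^ kk))) + (D' ∘ₗ pull (liftMap (kingPrV L kk r M) ι) - D) := by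
      rw [LinearMap.add_comp]; abel
    rw [hsplitQ]; exact hasMaj_add_exp hc hDd
  -- nonnegativity of the sizes
  have hq1 : (0 : ℝ) ≤ 1 * Real.exp δG := by positivity
  have hq2 : (0 : ℝ) ≤ 1 * Real.exp δG + ρE := by positivity
  have hτT : 0 ≤ θ + m₀ * ((((L ^ kk : ℕ) : ℝ)) ^ (-(1 / 16 : ℝ))) := by positivity
  have hτA : (0 : ℝ) ≤ 2 * Real.exp δG / (L : ℝ) ^ kk * 1 + τE := by positivity
  have hτQ : (0 : ℝ) ≤ 2 * Real.exp δG / ((L ^ kk : ℕ) : ℝ) * 1 + τD := by positivity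
  have hτA' : (0 : ℝ) ≤ 2 * Real.exp δG / (L : ℝ) ^ kk * 1 := by positivity
  have hτQ' : (0 : ℝ) ≤ 2 * Real.exp δG / ((L ^ kk : ℕ) : ℝ) * 1 := by positivity
  -- the three sandwich letters at each spacing and the three η-difference letters ((Q-1))
  have hS1c := hasMaj_sandwich_exp_ofBlocks htri hd hδG.le hc₂0.le hrow₂ hrow₄ hq1 hζ hq1 hQc hYc₀ hAc
  have hS1f := hasMaj_sandwich_exp_ofBlocks htri hd hδG.le hc₂0.le hrow₂ hrow₄ hq1 hζ hq1 hQf hYf₀ hAf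
  have hS2c := hasMaj_sandwich_exp_ofBlocks htri hd hδG.le hc₂0.le hrow₂ hrow₄ hρD hBX0.le hq2 hDc hXc₀ hAUc
  have hS2f := hasMaj_sandwich_exp_ofBlocks htri hd hδG.le hc₂0.le hrow₂ hrow₄ hρD hBX0.le hq2 hDf hXf₀ hAUf
  have hS3c := hasMaj_sandwich_exp_ofBlocks htri hd hδG.le hc₂0.le hrow₂ hrow₄ hq1 hBX0.le hρE hQc hXc₀ hEc
  have hS3f := hasMaj_sandwich_exp_ofBlocks htri hd hδG.le hc₂0.le hrow₂ hrow₄ hq1 hBX0.le hρE hQf hXf₀ hEf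
  have hS1d := hasMaj_sandwich_sub_exp_ofBlocks htri hd hδG.le hc₂0.le hrow₂ hrow₄ hq1 hζ hq1 hθ hτA' hτQ' hQf hYf₀ hYc₀ hAc hYd₀ hb hc
  have hS2d := hasMaj_sandwich_sub_exp_ofBlocks htri hd hδG.le hc₂0.le hrow₂ hrow₄ hρD hBX0.le hq2 hτT hτA hτD hDf hXf₀ hXc₀ hAUc hXI hAUd hDd
  have hS3d := hasMaj_sandwich_sub_exp_ofBlocks htri hd hδG.le hc₂0.le hrow₂ hrow₄ hq1 hBX0.le hρE hτT hτE hτQ' hQf hXf₀ hXc₀ hEc hXI hEd hc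
  -- read as coloured entry letters ((J-a) §2), all at the rate `δ_G∕4`
  set t : ℝ := (((L ^ kk : ℕ) : ℝ)) ^ (-(1 / 16 : ℝ)) with ht
  set η : ℝ := ((((L ^ kk : ℕ) : ℝ))⁻¹) with hη
  have hU := fun (T : ((Tor M × Fin (d + 1)) × ι → ℝ) →ₗ[ℝ] ((Tor M × Fin (d + 1)) × ι → ℝ)) {B : ℝ} (hB : 0 ≤ B)
      (h : HasMaj (BlockNorm.ofBlocks (unitTorusGeo L kk M) (liftBlk (fun bb : Tor M × Fin (d + 1) => bb.1) ι))
        (BlockNorm.ofBlocks (unitTorusGeo L kk M) (liftBlk (fun bb : Tor M × Fin (d + 1) => bb.1) ι)) T (fun y y' => B * Real.exp (-(δG / 4 * tdistT M y y'))))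
      (p q : B4.Idx (pbox M) (d + 1) × ι) => abs_unitBondMatC_le_of_hasMaj M kk ι (δ := δG / 4) hB h p q
  have hKe₁ : c₂ * c₄ * (Real.exp δG * Real.exp δG + BX * (Real.exp δG + 1) + Real.exp δG * BX) ≤ K := by
    have h2 : 0 ≤ 4 * (c₂ * c₄) * ampUnit (Real.exp δG) BX m₀ := mul_nonneg (by positivity) (ampUnit_nonneg he₀0.le hBX0.le hm₀.le)
    rw [hK]; linarith
  have hKe₃ : 4 * (c₂ * c₄) * ampUnit (Real.exp δG) BX m₀ ≤ K := by
    have h1 : 0 ≤ c₂ * c₄ * (Real.exp δG * Real.exp δG + BX * (Real.exp δG + 1) + Real.exp δG * BX) := by positivity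
    rw [hK]; linarith
  refine ⟨fun p q => ?_, fun p q => ?_, fun p q => ?_⟩
  · -- (i)
    have hE := Real.exp_nonneg (-(δG / 4 * cdist M ι p q))
    have hamp := amp_any_size_le (c := c₂ * c₄) (e₀ := Real.exp δG) (ζ := ζ) (ρD := ρD) (ρE := ρE) (B := BX) hcc0 he₀0.le hζ hρD hρE hρE1 hBX0.le hKe₁
    have e1 := hU _ (B := 1 * Real.exp δG * ζ * (1 * Real.exp δG) * c₂ * c₄) (by positivity) hS1c p q
    have e2 := hU _ (B := ρD * BX * (1 * Real.exp δG + ρE) * c₂ * c₄) (by positivity) hS2c p q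
    have e3 := hU _ (B := 1 * Real.exp δG * BX * ρE * c₂ * c₄) (by positivity) hS3c p q
    rw [zAnyC_split, Matrix.add_apply, Matrix.add_apply]
    refine (abs_add_three _ _ _).trans ((add_le_add (add_le_add e1 e2) e3).trans ?_)
    clear e1 e2 e3
    linarith [mul_le_mul_of_nonneg_right hamp hE]
  · -- (ii)
    have hE := Real.exp_nonneg (-(δG / 4 * cdist M ι p q))
    have hamp := amp_any_size_le (c := c₂ * c₄) (e₀ := Real.exp δG) (ζ := ζ) (ρD := ρD) (ρE := ρE) (B := BX) hcc0 he₀0.le hζ hρD hρE hρE1 hBX0.le hKe₁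
    have e1 := hU _ (B := 1 * Real.exp δG * ζ * (1 * Real.exp δG) * c₂ * c₄) (by positivity) hS1f p q
    have e2 := hU _ (B := ρD * BX * (1 * Real.exp δG + ρE) * c₂ * c₄) (by positivity) hS2f p q
    have e3 := hU _ (B := 1 * Real.exp δG * BX * ρE * c₂ * c₄) (by positivity) hS3f p q
    rw [zAnyF_split, Matrix.add_apply, Matrix.add_apply]
    refine (abs_add_three _ _ _).trans ((add_le_add (add_le_add e1 e2) e3).trans ?_)
    clear e1 e2 e3
    linarith [mul_le_mul_of_nonneg_right hamp hE]
  · -- (iii)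
    have hE := Real.exp_nonneg (-(δG / 4 * cdist M ι p q))
    have hamp := amp_any_defect_le (c := c₂ * c₄) (e₀ := Real.exp δG) (ζ := ζ) (θ := θ) (θG := m₀ * t) (m := m₀) (t := t) (η := η) (ρD := ρD) (ρE := ρE)
      (τD := τD) (τE := τE) (B := BX) hcc0 he₀0.le hζ hθ (by positivity) hm₀.le le_rfl hθ0 hη0 hηθ hρD hρD1 hρE hρE1 hτD hτE hBX0.le hKe₃
    have hdiv1 : 2 * Real.exp δG / (L : ℝ) ^ kk * 1 = 2 * Real.exp δG * η := by rw [hcast, div_eq_mul_inv, mul_one]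
    have hdiv2 : 2 * Real.exp δG / ((L ^ kk : ℕ) : ℝ) * 1 = 2 * Real.exp δG * η := by rw [div_eq_mul_inv, mul_one]
    have hsplit : zAnyF d ι a hL mv kk r Xf D' E' p q - zAnyC d ι a hL mv kk Xc D E p q =
        (unitBondMatC M ι (tensorId ι (qvRe M (L ^ r * L ^ kk)) ∘ₗ (Xf - tensorId ι (gOp M (L ^ r * L ^ kk) a)) ∘ₗ tensorId ι (qvAdjRe M (L ^ r * L ^ kk)) -
            tensorId ι (qvRe M (L ^ kk)) ∘ₗ (Xc - tensorId ι (gOp M (L ^ kk) a)) ∘ₗ tensorId ι (qvAdjRe M (L ^ kk))) p q) +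
        (unitBondMatC M ι (D' ∘ₗ Xf ∘ₗ (tensorId ι (qvAdjRe M (L ^ r * L ^ kk)) + E') - D ∘ₗ Xc ∘ₗ (tensorId ι (qvAdjRe M (L ^ kk)) + E)) p q) +
        (unitBondMatC M ι (tensorId ι (qvRe M (L ^ r * L ^ kk)) ∘ₗ Xf ∘ₗ E' - tensorId ι (qvRe M (L ^ kk)) ∘ₗ Xc ∘ₗ E) p q) := by
      rw [zAnyF_split, zAnyC_split, unitBondMatC_sub, unitBondMatC_sub, unitBondMatC_sub]
      simp only [Matrix.add_apply, Matrix.sub_apply]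
      abel
    have e1 := hU _ (B := c₂ * c₄ * (1 * Real.exp δG * ζ * (2 * Real.exp δG / (L : ℝ) ^ kk * 1) + 1 * Real.exp δG * (1 * Real.exp δG) * θ +
      ζ * (1 * Real.exp δG) * (2 * Real.exp δG / ((L ^ kk : ℕ) : ℝ) * 1))) (by positivity) hS1d p q
    have e2 := hU _ (B := c₂ * c₄ * (ρD * BX * (2 * Real.exp δG / (L : ℝ) ^ kk * 1 + τE) + ρD * (1 * Real.exp δG + ρE) * (θ + m₀ * t) +
      BX * (1 * Real.exp δG + ρE) * τD)) (by positivity) hS2d p q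
    have e3 := hU _ (B := c₂ * c₄ * (1 * Real.exp δG * BX * τE + 1 * Real.exp δG * ρE * (θ + m₀ * t) + BX * ρE * (2 * Real.exp δG / ((L ^ kk : ℕ) : ℝ) * 1)))
      (by positivity) hS3d p q
    rw [hsplit]
    refine (abs_add_three _ _ _).trans ((add_le_add (add_le_add e1 e2) e3).trans ?_)
    clear e1 e2 e3 hsplit
    rw [hdiv1, hdiv2]
    linarith [mul_le_mul_of_nonneg_right hamp hE]

end Summit.QuantumFields.YangMills.BalabanUVNodes.N15.GluedZeroField
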